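import Literature.AlgebraicGeometry.HodgeTheory.WeilClassesMoonenZarhinCriterionHolds
import Literature.AlgebraicGeometry.HodgeTheory.WeilClassesFieldGeneratorChange
import Literature.AlgebraicGeometry.HodgeTheory.WeilClassesSixfoldsProofs
import Literature.AlgebraicGeometry.HodgeTheory.AlgebraicClassesCupAbelianVarietyDiagonal
import Literature.AlgebraicGeometry.HodgeTheory.LefschetzOneOneHolds
import Literature.AlgebraicGeometry.HodgeTheory.WeilClassesDescendingOfLefschetzOneOne
import Literature.AlgebraicGeometry.Deligne1982.WeilTypeCMHodgeRing
import Summits.HodgeConjecture.HodgeConjecture.Theorems.WeilTypeLadderOnPath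
import HarnessLib

/-!
# WeilTypeLadder · Weil classes of `K ⊂ E`, `E = ℚ(θ)` a field of degree `dim A` acting with `E`-rank `2` and balanced multiplicities — `W_K ⊗ ℂ ⊆ Nⁿ` UNCONDITIONALLY (Lefschetz `(1,1)` only); the type-II loci of the non-split Weil components

b2b cell `hweil` (packet `run/shared/lean/b2b/hodge-weil/`, `b2b-hweil-pv3-g36/TYPE-II-LOCI.md`; prover 3, "special cases
with classical tools"). A companion of `Literature/…/WeilClassesProductsOfFactors.lean` (the `K`-PRODUCT loci of the
census, ## P3-g3) and of `Theorems/WeilTypeLadderQuaternionicPrymSixfolds.lean` (the quaternionic Prym loci, ## P3-g35):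
the third classical mechanism placing positive-dimensional loci with ALGEBRAIC Weil classes inside the NON-split
components of the Weil-type moduli — this time for EVERY imaginary quadratic `K`, EVERY discriminant class, EVERY
`n ≥ 2`, with SIMPLE general members, and with NO named fact at all.

THE MECHANISM (Moonen–Zarhin, *Weil classes on abelian varieties*, Crelle 496 (1998) = alg-geom/9612017, §1–2). For a
field `E ⊂ End⁰(A)` with `r = 2 dim A/[E:ℚ]`, `W_E := ⋀^r_E H¹(A, ℚ) ⊂ H^r(A, ℚ)`, `W_E ⊗ ℂ = ⊕_σ ⋀^r V_{ℂ,σ}`;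
for a subfield `K ⊂ E`, `⋀^{r[E:K]} V_{ℂ,τ}(K) = ⊗_{σ|τ} ⋀^r V_{ℂ,σ}`, so `W_K` lies in the span of `[E:K]`-fold cup
products of classes of `W_E` (loc. cit. §2, the tensor decomposition; the tree's `WeilClassesMoonenZarhinCriterion`
docstring lists this "norm/restriction relation for `F ⊂ F′`" as deliberately not yet typed). Take `K = ℚ(√-d)`
imaginary quadratic, `dim A = 2n`, `[E:ℚ] = 2n` (so `r = 2` and `W_E ⊂ H²`): if the multiplicities of `E` are
balanced (`n_σ = n_σ̄ = 1`), `W_E` consists of Hodge classes (Criterion §1, PROVED in the tree: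
`isOfHodgeType_of_mem_weilClassesField_of_balanced`) which are rational `(1,1)`-classes — DIVISOR classes
(`lefschetzOneOne_rational_holds`) — and `W_K ⊆ ⟨W_E^{∪ n}⟩ ⊆ 𝒟ⁿ(A)` is DECOMPOSABLE, in particular algebraic.
Moonen–Zarhin's second Criterion says the same in Albert's language: for `A ~ Yᵐ` with `Y` of type 1 or 2 and ANY
subfield `F ⊂ End⁰(A)` with `W_F` Hodge, "all classes in `W_F` are decomposable" (exceptional classes need type 3
or 4); and their Remark: "If all simple factors of `X` are of type 1, 2 or 3 … every subfield `F ⊆ End⁰(X)` satisfies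
`n_σ = n_σ′`". V. K. Murty (Proc. AMS 104 (1988), Thm. 2) proves more for such `A` (`𝓑(Aᵏ) = 𝓓(Aᵏ)`, all `k`),
vendored in the tree by ring 2 as a named fact; NOTHING of it is used here.

THIS FILE (kernel; no `sorry`; NO named fact, NO definition):
* `cupPowOne_mem_algebraicClasses_of_pairs` — a `2m`-fold cup product of `H¹`-classes whose consecutive pairs have
  algebraic products is algebraic (products on an abelian variety, `AbelianVariety.cupProduct_mem_algebraicClasses'`).
* `weilClassesOf_le_algebraicClasses_of_rankTwoCMField` — MAIN THEOREM: `A` of dimension `2n` (`n ≥ 1`),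
  `φ ≫ φ = -(d • 𝟙 A)` (`d ≥ 1`), `θ` with `P(θ) = 0`, `P ∈ ℤ[T]` monic of degree `2n` irreducible over `ℚ`,
  `N • φ = S(θ)` (`N ≥ 1`, `S ∈ ℤ[T]`: `K = ℚ(φ) ⊂ E = ℚ(θ)`), balanced multiplicities
  (`eigenMultiplicity A θ ρ = eigenMultiplicity A θ ρ̄` at every root) ⟹ `weilClassesOf A φ n d ≤ algebraicClasses A.X n`.
  Proof on the carriers: `H¹ = ⊕_{P(ρ)=0} V_ρ`, `dim V_ρ = 2` (`finrank_eigenspace_eq_of_root`); `φ^* = S(θ^*)/N`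
  acts on `V_ρ` by `s(ρ)` with `s(ρ)² = -d`; the `2n` roots split into `R± = {s = ± i√d}`, swapped by complex
  conjugation, `|R₊| = n`; `ω := ⌣_{ρ ∈ R₊} (u_ρ ⌣ v_ρ)` (`u_ρ, v_ρ` an eigenbasis of `V_ρ`) is NON-ZERO
  (`cupPowOne_ne_zero_of_linearIndependent`), lies in `E₊ = weilClassesPlus` (`cupPowOne_mem_pullbackEigenclasses_pow`)
  and is ALGEBRAIC, each `u_ρ ⌣ v_ρ` lying in `⋀² V_ρ ⊆ W_E ⊗ ℂ ⊆ N¹ H²` (`weilClassesField_le_of_forall_isRationalClass`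
  + Criterion (i) + Lefschetz); one non-zero algebraic Weil class makes the plane algebraic
  (`weilClassesOf_le_algebraicClasses_of_exists_ne_zero`).
* The literal rung bodies on this locus — R∞ (`WeilClassesImaginaryQuadratic`, every `n ≥ 2`) and the FIRST RUNG
  ABOVE THE FLOOR R1′ (`NonsplitSixfolds`, `n = 3`) — with their on-path lemmas are in the sibling
  `Theorems/WeilTypeLadderRankTwoCMFieldRungs.lean`.

WHICH ABELIAN VARIETIES (packet `TYPE-II-LOCI.md` §2, pen-and-paper, standard): `h(U(1)) ⊂ Res_{F₀/ℚ} SU(H_E)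
= Res SL₁(D)`, so `End⁰(A) ⊇ D ≅ (-d, -disc H_E)_{F₀}`: the `2n`-folds of the theorem are exactly those of Albert
TYPE II(`n`) with `m = 1` — `End⁰(A) ⊇ D`, a totally indefinite quaternion algebra over the totally real field
`F₀ = E ∩ ℝ` of degree `n`, `E = K·F₀ ⊂ D` (an `n`-dimensional Shimura family `S_D` for each `D`; general member
SIMPLE with `End⁰ = D` when `D` is a division algebra) — together with the split case `D = M₂(F₀)` (`A ~ Y × Y`, `Y`
with real multiplication by `F₀`) and the CM points (`B_Φ × B_Φ̄`). WHICH COMPONENTS (packet §3, THEOREM DISC-II,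
one paragraph + exact machine check): for an `E`-compatible polarization, van Geemen's `H_K = -2d · Tr_{E/K} ∘ H_E`,
hence `det H_K ≡ N_{F₀/ℚ}(disc H_E) ≡ (-1)ⁿ N_{F₀/ℚ}(u)` for `D ≅ (-d, u)_{F₀}`, `u ≫ 0`: `(A, K)` is SPLIT iff
`N_{F₀/ℚ}(u) ∈ Nm(K^×)`. For `n` odd and ANY class `-c`, `c > 0`, `c ∉ Nm(K^×)`, the algebra `(-d, c)_ℚ ⊗ F₀` is a
totally indefinite DIVISION algebra for every totally real `F₀` of degree `n` (odd degree cannot split it), of class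
`-cⁿ ≡ -c`: EVERY NON-SPLIT SIXFOLD COMPONENT OF EVERY `K` CONTAINS 3-DIMENSIONAL FAMILIES OF SIMPLE ABELIAN
SIXFOLDS WITH ALGEBRAIC (indeed decomposable) WEIL CLASSES — e.g. `(ℚ(√-3), 3, -2)`, the component of the cell's
twelve open `ℤ/6`-cover families, contains `S_D` for `D = (-3, 2)_ℚ ⊗ ℚ(ζ₇ + ζ₇⁻¹)`. (Eightfolds: packet §3.4.)

HONEST LABEL. CASES of R1′ / R∞ on proper sub-loci (dimension `n` inside the `n²`-dimensional components), NOT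
rungs; 0 unconditional rungs above the floor are added. The algebraicity is classical and in print (Moonen–Zarhin 1998;
Murty 1988 for the whole Hodge ring); NEW for the cell: (i) a fact-free kernel proof on the ladder's carriers
`weilClassesOf` (before: the only unconditional positive-dimensional loci of the census were the degenerate products
`S₁ × S₂ × S₃`), (ii) the placement of these loci in EVERY non-split component (DISC-II), which the three primaries of
the cell (Markman 2025, Mostaed 2026) and Moonen–Zarhin do not discuss. Markman's statements are not used anywhere.
-/
noncomputable section

-- every declaration of this problem lives in `Summit.HodgeConjecture.HodgeConjecture.…` (summit = sub-problem)
set_option linter.dupNamespace false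

open CategoryTheory
open Literature.AlgebraicGeometry Literature.AlgebraicGeometry.Motives
open Literature.AlgebraicGeometry.HodgeTheory
open Literature.AlgebraicTopology.SingularHomology

namespace Summit.HodgeConjecture.HodgeConjecture.WeilTypeLadder

section RankTwoCMField

/-- **A product of `m` algebraic degree-`2` products is algebraic.** On a complex abelian variety `A`, if
`w : Fin (2m) → H¹(A(ℂ); ℂ)` is a family of degree-one classes whose consecutive PAIRS have algebraic cup
products `w_{2k} ⌣ w_{2k+1} ∈ N¹ H²` (`k < m`), then `w₀ ⌣ ⋯ ⌣ w_{2m-1} ∈ Nᵐ H^{2m}`: split off the last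
pair (`cupPowOne_eq_cupProduct_split`) and use that products of algebraic classes on an abelian variety are
algebraic (`AbelianVariety.cupProduct_mem_algebraicClasses'`, Voisin II Prop. 9.20, proved in the tree).
[cite: VoisinHodgeII2003, Prop. 9.20] -/
theorem cupPowOne_mem_algebraicClasses_of_pairs (A : AbelianVariety ℂ) :
    ∀ (m : ℕ) (w : Fin (2 * m) → complexBetti A.X 1),
      (∀ k : Fin m, cupPowOne ℂ (ComplexPoints A.X) (2 * 1)
          (fun j : Fin (2 * 1) => w ⟨2 * k.val + j.val, by omega⟩) ∈ algebraicClasses A.X 1) →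
      cupPowOne ℂ (ComplexPoints A.X) (2 * m) w ∈ algebraicClasses A.X m := by
  intro m
  induction m with
  | zero =>
    intro w _
    rw [algebraicClasses_zero]
    exact Submodule.mem_top
  | succ m ih =>
    intro w hw
    have h : 2 * m + 2 * 1 = 2 * (m + 1) := by ring
    rw [cupPowOne_eq_cupProduct_split ℂ (2 * m) (2 * 1) h w]
    refine AbelianVariety.cupProduct_mem_algebraicClasses' A h (ih _ fun k => ?_) ?_
    · exact hw ⟨k.val, by omega⟩
    · exact hw ⟨m, by omega⟩

/-- **MAIN THEOREM — `W_K ⊗ ℂ ⊆ Nⁿ` for an imaginary quadratic `K = ℚ(φ) ⊂ E = ℚ(θ) ⊂ End⁰(A)`, `E` a field of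
degree `2n = dim A` (so `dim_E H¹(A, ℚ) = 2`) acting with BALANCED multiplicities (`n_σ = n_σ̄ (= 1)` for every
embedding `σ : E → ℂ`).** Carriers: `A` a complex abelian variety with `dim A = 2n`, `n ≥ 1`; `φ ≫ φ = -(d • 𝟙 A)`,
`d ≥ 1` (`K = ℚ(√-d)`); `θ : A ⟶ A` with `P(θ) = 0` for `P ∈ ℤ[T]` monic of degree `2n`, irreducible over `ℚ`
(`E = ℚ(θ) ≅ ℚ[T]/(P)`); `N • φ = S(θ)` in `End A` for some `S ∈ ℤ[T]`, `N ≥ 1` (`φ ∈ ℚ(θ)`, i.e. `K ⊂ E`); and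
`eigenMultiplicity A θ ρ = eigenMultiplicity A θ ρ̄` for every complex root `ρ` of `P`. CONCLUSION:
`weilClassesOf A φ n d ≤ algebraicClasses A.X n`. PROOF (Moonen–Zarhin 1998 §2, "`W_F` is contained in the span of
exterior products of elements of `W_{F'}`" for `F ⊂ F'`, here `K ⊂ E`, composed with their §1 Criterion and the
rational Lefschetz `(1,1)` theorem — all PROVED in the tree, so NO named fact is used): `θ^*` is diagonalisable on
`H¹ = ⊕_{P(ρ)=0} V_ρ` with `dim V_ρ = 2` (`finrank_eigenspace_eq_of_root`); `φ^* = S(θ^*)/N` acts on `V_ρ` by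
`s(ρ) = S(ρ)/N` with `s(ρ)² = -d`, so the `2n` roots split into `Rp = {s = i√d}` and `Rm = {s = -i√d}`, swapped by
complex conjugation, `|Rp| = n`; for `ρ ∈ Rp` the line `⋀² V_ρ ⊆ W_E ⊗ ℂ ⊆ H²` is spanned by rational classes
(`weilClassesField_eq_span_isRationalClass`) of Hodge type `(1,1)` (Criterion (i), balanced), hence ALGEBRAIC
(`lefschetzOneOne_rational_holds`); the cup product over `ρ ∈ Rp` of basis wedges `u_ρ ⌣ v_ρ` is a NON-ZERO
(`cupPowOne_ne_zero_of_linearIndependent`) ALGEBRAIC (products on an abelian variety,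
`AbelianVariety.cupProduct_mem_algebraicClasses'`) class of the Weil line `E₊ = ⋀^{2n} V₊(φ)`
(`cupPowOne_mem_pullbackEigenclasses_pow`); one non-zero algebraic Weil class makes the plane algebraic
(`weilClassesOf_le_algebraicClasses_of_exists_ne_zero`). WHO: the abelian `2n`-folds with such an `E ⊃ K` are those
of Albert type II(`n`) with `m = 1` — `End⁰(A) ⊇ D` a totally indefinite quaternion algebra over a totally real field
`F₀` of degree `n`, `E = K·F₀ ⊂ D` — and their degenerations (`Y × Y`, `Y` with real multiplication by `F₀`;
`B_Φ × B_Φ̄`); see the cell packet `b2b-hweil-pv3-g36/TYPE-II-LOCI.md` for which Weil components they populate.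
[cite: MoonenZarhin1998WeilClasses, §1 Criterion and §2] [cite: vanGeemen1994HodgeAV, 4.9 and proof of Thm. 6.12]
[cite: VoisinHodgeII2003, Prop. 9.20] [cite: VoisinHodgeI2002, Thm. 11.30] -/
theorem weilClassesOf_le_algebraicClasses_of_rankTwoCMField {A : AbelianVariety ℂ} {n d N : ℕ}
    (hn : 0 < n) (hd : 0 < d) (hA : A.dim = 2 * n) {φ θ : A ⟶ A} (hφ : φ ≫ φ = -(d • 𝟙 A))
    {P S : Polynomial ℤ} (hPm : P.Monic) (hPe : P.natDegree = 2 * n)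
    (hPirr : Irreducible (P.map (Int.castRingHom ℚ)))
    (hθ : Polynomial.eval₂ (Int.castRingHom (CategoryTheory.End A)) (θ : CategoryTheory.End A) P = 0)
    (hN : 0 < N)
    (hS : ((N • φ : A ⟶ A) : CategoryTheory.End A) =
      Polynomial.eval₂ (Int.castRingHom (CategoryTheory.End A)) (θ : CategoryTheory.End A) S)
    (hbal : ∀ ρ : ℂ, Polynomial.eval₂ (Int.castRingHom ℂ) ρ P = 0 →
      eigenMultiplicity A θ ρ = eigenMultiplicity A θ (starRingEnd ℂ ρ)) :
    weilClassesOf A φ n d ≤ algebraicClasses A.X n := by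
  classical
  haveI := finite_complexBetti_abelianVariety A 1
  have hΛ := AbelianVariety.hasExteriorCohomologyH1_complexPoints A
  have hb₁ : Module.finrank ℂ (complexBetti A.X 1) = 2 * (2 * n) := by
    rw [AbelianVariety.finrank_complexBetti_one, hA]
  have hX : IsSmoothProjective A.dim A.X := AbelianVariety.isSmoothProjective_holds (A := A)
  have her : 2 * n * 2 = 2 * A.dim := by rw [hA]; ring
  have her' : 2 * n * (2 * 1) = 2 * A.dim := by rw [hA]; ring
  set T : Module.End ℂ (complexBetti A.X 1) := (complexBetti.map θ.hom.hom.hom 1).hom with hT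
  set F : Module.End ℂ (complexBetti A.X 1) := (complexBetti.map φ.hom.hom.hom 1).hom with hF
  set μ : ℂ := Complex.I * (Real.sqrt d : ℂ) with hμ
  set s : ℂ → ℂ := fun ρ => Polynomial.eval₂ (Int.castRingHom ℂ) ρ S / (N : ℂ) with hs
  have hN' : (N : ℂ) ≠ 0 := Nat.cast_ne_zero.2 hN.ne'
  -- (1) `φ^*` acts on `V_ρ(θ)` by the scalar `s ρ = S(ρ)/N`
  have hFρ : ∀ {ρ : ℂ} {v : complexBetti A.X 1}, v ∈ Module.End.eigenspace T ρ → F v = s ρ • v := by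
    intro ρ v hv
    have h1 := Module.End.mem_eigenspace_iff.1 (mem_eigenspace_map_one_of_eq_eval₂ hS hv)
    have h2 : (complexBetti.map (N • φ).hom.hom.hom 1).hom v = (N : ℂ) • F v := by
      rw [complexBetti_map_nsmul_one, ModuleCat.hom_nsmul, LinearMap.smul_apply, Nat.cast_smul_eq_nsmul]
    rw [h2] at h1
    calc F v = (N : ℂ)⁻¹ • ((N : ℂ) • F v) := by rw [smul_smul, inv_mul_cancel₀ hN', one_smul]
      _ = s ρ • v := by
        rw [h1, smul_smul]
        simp only [hs, div_eq_inv_mul]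
  -- (2) `dim V_ρ = 2` at every root, and `s(ρ) = ± μ`
  have hdim : ∀ {ρ : ℂ}, Polynomial.eval₂ (Int.castRingHom ℂ) ρ P = 0 →
      Module.finrank ℂ (Module.End.eigenspace T ρ) = 2 := fun hρ =>
    finrank_eigenspace_eq_of_root hPm hPe hPirr hθ her hρ
  have hμ2 : μ ^ 2 = -(d : ℂ) := I_mul_sqrt_sq d
  have hμ0 : μ ≠ 0 := I_mul_sqrt_ne_zero hd
  have hsq : ∀ {ρ : ℂ}, Polynomial.eval₂ (Int.castRingHom ℂ) ρ P = 0 → s ρ = μ ∨ s ρ = -μ := by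
    intro ρ hρ
    have hne : Module.End.eigenspace T ρ ≠ ⊥ := by
      intro h
      have h2 := hdim hρ
      rw [h, finrank_bot] at h2
      exact two_ne_zero h2.symm
    obtain ⟨v, hv, hv0⟩ := Submodule.exists_mem_ne_zero_of_ne_bot hne
    have h1 : F (F v) = (s ρ ^ 2) • v := by rw [hFρ hv, map_smul, hFρ hv, smul_smul, sq]
    have h2 : F (F v) = -((d : ℂ) • v) := complexBetti_map_map_one_of_comp_self hφ v
    have h3 : (s ρ ^ 2 - μ ^ 2) • v = 0 := by
      rw [sub_smul, ← h1, h2, hμ2, neg_smul, sub_self]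
    exact sq_eq_sq_iff_eq_or_eq_neg.1 (sub_eq_zero.1 ((smul_eq_zero.1 h3).resolve_right hv0))
  -- (3) the roots `R`, `|R| = 2n`, and the halves `Rp`, `Rm` swapped by conjugation, `|Rp| = n`
  have hP0 : P ≠ 0 := hPm.ne_zero
  have hsepC : (P.map (Int.castRingHom ℂ)).Separable := by
    rw [map_castRingHom_complex_eq]; exact hPirr.separable.map
  set R : Finset ℂ := (P.map (Int.castRingHom ℂ)).roots.toFinset with hR
  have hmemR : ∀ {ρ : ℂ}, ρ ∈ R ↔ Polynomial.eval₂ (Int.castRingHom ℂ) ρ P = 0 := fun {ρ} =>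
    mem_roots_toFinset_map_iff hP0 ρ
  have hRcard : R.card = 2 * n := by
    rw [hR, Multiset.toFinset_card_of_nodup (Polynomial.nodup_roots hsepC),
      Polynomial.splits_iff_card_roots.1 (IsAlgClosed.splits _),
      Polynomial.natDegree_map_eq_of_injective (RingHom.injective_int (Int.castRingHom ℂ)), hPe]
  set Rp : Finset ℂ := R.filter (fun ρ => s ρ = μ) with hRp
  set Rm : Finset ℂ := R.filter (fun ρ => s ρ = -μ) with hRm
  have hsconj : ∀ ρ : ℂ, s (starRingEnd ℂ ρ) = starRingEnd ℂ (s ρ) := by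
    intro ρ
    rw [hs]
    change Polynomial.eval₂ (Int.castRingHom ℂ) (starRingEnd ℂ ρ) S / (N : ℂ) =
      starRingEnd ℂ (Polynomial.eval₂ (Int.castRingHom ℂ) ρ S / (N : ℂ))
    rw [map_div₀, map_natCast, Literature.AlgebraicGeometry.Deligne1982.eval₂_conj]
  have hμconj : starRingEnd ℂ μ = -μ := by
    rw [hμ, map_mul, Complex.conj_I, Complex.conj_ofReal, neg_mul]
  have hconjR : ∀ {ρ : ℂ}, ρ ∈ R → starRingEnd ℂ ρ ∈ R := by
    intro ρ hρ
    rw [hmemR] at hρ ⊢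
    rw [Literature.AlgebraicGeometry.Deligne1982.eval₂_conj, hρ, map_zero]
  have hmaps₁ : Set.MapsTo (starRingEnd ℂ) ↑Rp ↑Rm := by
    intro ρ hρ
    rw [Finset.mem_coe, hRp, Finset.mem_filter] at hρ
    rw [Finset.mem_coe, hRm, Finset.mem_filter]
    exact ⟨hconjR hρ.1, by rw [hsconj, hρ.2, hμconj]⟩
  have hmaps₂ : Set.MapsTo (starRingEnd ℂ) ↑Rm ↑Rp := by
    intro ρ hρ
    rw [Finset.mem_coe, hRm, Finset.mem_filter] at hρ
    rw [Finset.mem_coe, hRp, Finset.mem_filter]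
    exact ⟨hconjR hρ.1, by rw [hsconj, hρ.2, map_neg, hμconj, neg_neg]⟩
  have hinj : ∀ Z : Set ℂ, Set.InjOn (starRingEnd ℂ) Z := fun Z => (starRingEnd ℂ).injective.injOn
  have hle₁ : Rp.card ≤ Rm.card := Finset.card_le_card_of_injOn _ hmaps₁ (hinj _)
  have hle₂ : Rm.card ≤ Rp.card := Finset.card_le_card_of_injOn _ hmaps₂ (hinj _)
  have hdisj : Disjoint Rp Rm := by
    rw [hRp, hRm, Finset.disjoint_filter]
    intro ρ _ h1 h2
    rw [h1] at h2
    have h2μ : (2 : ℂ) * μ = 0 := by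
      rw [two_mul]
      nth_rewrite 1 [h2]
      rw [neg_add_cancel]
    exact hμ0 ((mul_eq_zero.1 h2μ).resolve_left two_ne_zero)
  have hunion : Rp ∪ Rm = R := by
    ext ρ
    rw [Finset.mem_union, hRp, hRm, Finset.mem_filter, Finset.mem_filter]
    constructor
    · rintro (⟨h, -⟩ | ⟨h, -⟩) <;> exact h
    · intro h
      rcases hsq (hmemR.1 h) with h1 | h1
      · exact Or.inl ⟨h, h1⟩
      · exact Or.inr ⟨h, h1⟩
  have hRpcard : Rp.card = n := by
    have hc := Finset.card_union_of_disjoint hdisj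
    rw [hunion, hRcard] at hc
    omega
  -- (4) enumerate `Rp`; an eigenbasis of `H¹` adapted to `θ^*`; the family `w` of `2n` eigenvectors, two per root of `Rp`
  let e : Fin n ≃ ↥Rp := (Finset.equivFinOfCardEq hRpcard).symm
  have heRp : ∀ k : Fin n, (e k : ℂ) ∈ R ∧ s (e k : ℂ) = μ := fun k => Finset.mem_filter.1 (e k).2
  have heR : ∀ k : Fin n, Polynomial.eval₂ (Int.castRingHom ℂ) (e k : ℂ) P = 0 := fun k =>
    hmemR.1 (heRp k).1
  have hTP : Polynomial.aeval T (P.map (Int.castRingHom ℂ)) = 0 := aeval_hom_complexBetti_map_one_eq_zero hθ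
  have hss : Module.End.IsSemisimple T :=
    Module.End.isSemisimple_of_squarefree_aeval_eq_zero hsepC.squarefree hTP
  have hint : DirectSum.IsInternal T.eigenspace :=
    DirectSum.isInternal_submodule_of_iSupIndep_of_iSup_eq_top T.eigenspaces_iSupIndep
      hss.iSup_eigenspace_eq_top
  let bE : ∀ ρ : ℂ, Module.Basis (Fin (Module.finrank ℂ (T.eigenspace ρ))) ℂ (T.eigenspace ρ) :=
    fun ρ => Module.finBasis ℂ _
  let b₀ := hint.collectedBasis bE
  let half : Fin (2 * n) → Fin n := fun i => ⟨i.val / 2, by omega⟩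
  let par : Fin (2 * n) → Fin 2 := fun i => ⟨i.val % 2, Nat.mod_lt _ two_pos⟩
  let g' : Fin n → Fin 2 → (Σ ρ : ℂ, Fin (Module.finrank ℂ (T.eigenspace ρ))) := fun k j =>
    ⟨(e k : ℂ), Fin.cast (hdim (heR k)).symm j⟩
  let g : Fin (2 * n) → (Σ ρ : ℂ, Fin (Module.finrank ℂ (T.eigenspace ρ))) := fun i => g' (half i) (par i)
  have hg' : ∀ (k k' : Fin n) (j j' : Fin 2), g' k j = g' k' j' → k = k' ∧ j = j' := by
    intro k k' j j' h
    obtain ⟨h1, h2⟩ := Sigma.mk.inj_iff.1 h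
    have hk : k = k' := e.injective (Subtype.ext h1)
    subst hk
    exact ⟨rfl, Fin.cast_injective _ (eq_of_heq h2)⟩
  have hg : Function.Injective g := by
    intro i i' h
    obtain ⟨h1, h2⟩ := hg' _ _ _ _ h
    have h1' : i.val / 2 = i'.val / 2 := congrArg Fin.val h1
    have h2' : i.val % 2 = i'.val % 2 := congrArg Fin.val h2
    exact Fin.ext (by omega)
  let w : Fin (2 * n) → complexBetti A.X 1 := fun i => b₀ (g i)
  have hwT : ∀ i, w i ∈ Module.End.eigenspace T (e (half i) : ℂ) := fun i =>
    hint.collectedBasis_mem bE (g i)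
  have hwF : ∀ i, w i ∈ Module.End.eigenspace F μ := by
    intro i
    rw [Module.End.mem_eigenspace_iff, hFρ (hwT i), (heRp (half i)).2]
  have hwli : LinearIndependent ℂ w := b₀.linearIndependent.comp g hg
  -- (5) the class `ω = ⌣ᵢ wᵢ`: non-zero, in the Weil line `E₊`
  set ω := cupPowOne ℂ (ComplexPoints A.X) (2 * n) w with hω
  have hω0 : ω ≠ 0 := cupPowOne_ne_zero_of_linearIndependent A hwli
  have hωplus : ω ∈ weilClassesPlus A φ n d := by
    have h := cupPowOne_mem_pullbackEigenclasses_pow φ hwF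
    have e' : (fun x y : ℕ => ((x : ℂ) + (y : ℂ) * Complex.I * (Real.sqrt d : ℂ)) ^ (2 * n)) =
        fun x y : ℕ => ((x : ℂ) + (y : ℂ) * (Complex.I * (Real.sqrt d : ℂ))) ^ (2 * n) := by
      funext x y; rw [mul_assoc]
    rw [weilClassesPlus, e']
    exact h
  have hωW : ω ∈ weilClassesOf A φ n d := weilClassesPlus_le_weilClassesOf A φ n d hωplus
  -- (6) `ω` is algebraic: each pair `w_{2k} ⌣ w_{2k+1}` lies in `⋀² V_ρ ⊆ W_E ⊗ ℂ ⊆ N¹ H²`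
  have hWE : weilClassesField A θ P (2 * 1) ≤ algebraicClasses A.X 1 :=
    weilClassesField_le_of_forall_isRationalClass hPirr hθ fun c hc hcQ =>
      lefschetzOneOne_rational_holds hX c hcQ
        (isOfHodgeType_of_mem_weilClassesField_of_balanced hPm hPe hPirr hθ her' hbal hc)
  have hhalf : ∀ (k : Fin n) (j : Fin (2 * 1)), half ⟨2 * k.val + j.val, by omega⟩ = k := by
    intro k j
    apply Fin.ext
    change (2 * k.val + j.val) / 2 = k.val
    omega
  have hpair : ∀ k : Fin n, cupPowOne ℂ (ComplexPoints A.X) (2 * 1)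
      (fun j : Fin (2 * 1) => w ⟨2 * k.val + j.val, by omega⟩) ∈ algebraicClasses A.X 1 := by
    intro k
    have hjT : ∀ j : Fin (2 * 1), w ⟨2 * k.val + j.val, by omega⟩ ∈
        Module.End.eigenspace T (e k : ℂ) := by
      intro j
      have h := hwT ⟨2 * k.val + j.val, by omega⟩
      rwa [hhalf k j] at h
    exact hWE (pullbackEigenclasses_le_weilClassesField (heR k)
      (cupPowOne_mem_pullbackEigenclasses_pow θ hjT))
  have hωalg : ω ∈ algebraicClasses A.X n := cupPowOne_mem_algebraicClasses_of_pairs A n w hpair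
  exact weilClassesOf_le_algebraicClasses_of_exists_ne_zero hn hd hφ hΛ hb₁ ⟨ω, hωW, hωalg, hω0⟩


end RankTwoCMField

end Summit.HodgeConjecture.HodgeConjecture.WeilTypeLadder

end
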